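import Summits.HodgeConjecture.HodgeConjecture.Theorems.LimitExtensionHodgeFourfoldsOfFacts
import Summits.HodgeConjecture.HodgeConjecture.Theorems.LimitExtensionSpecialisationOfAlgebraicityOfSpread

/-!
# Route LimitExtension · `HodgeFourfolds` (stmt-HodgeConjecture-10866) — the finest leaf set

Companion of `Theorems/LimitExtensionHodgeFourfoldsOfFacts` (`hodgeFourfolds_of_facts`: the route
decl `HodgeFourfolds` from Lefschetz `(1,1)`, Deligne's Hodge III Cor. 8.2.8, the lifting of Hodge
classes along Gysin surjections, and the route's support item `SpecialisationOfAlgebraicity`,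
stmt-HodgeConjecture-2998) and of `Theorems/LimitExtensionSpecialisationOfAlgebraicityOfSpread`
(`specialisationOfAlgebraicity_of_spread`: stmt-2998 from the single classical ingredient SPREAD —
one Zariski-closed `𝒵 ⊆ W`, of codimension `≥ k` over `t₀`, off whose slices all the algebraic
classes `B_t`, `t ≠ t₀`, die; relative Hilbert/Chow schemes, countability and flat limits over the
smooth curve, Voisin II §3.3.1 and §7.3.2, Fulton 1998 §10.1). Composing the two replaces the fourth
input of `hodgeFourfolds_of_facts` by SPREAD, so that the item is exhibited CLOSED MODULO exactly

* `lefschetzOneOne_rational` (leaf: Serre's GAGA n° 20 Prop. 18 for line bundles,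
  `serreGAGA_lineCocycle_iso_cartierDivisorCocycle`),
* `Deligne1974_ker_restrictCompl_eq_iSup_range_complexGysin` (leaf: Hodge III Prop. 8.2.7,
  `Deligne1974_ker_pullback_eq_ker_pullback_resolution`),
* `Voisin2025_hodgeClass_lift_complexGysin` (leaf: the polarizability
  `smoothProjective_hodgeStructure_isPolarizable`),
* SPREAD (a plain hypothesis, the residual content of stmt-2998),

— `hodgeFourfolds_of_facts_of_spread` on the three named facts, `hodgeFourfolds_of_four_leaves` on
their three leaves. Each of the four is load-bearing (module docstring of
`LimitExtensionHodgeFourfolds`): codimension `1` and `3` of a fourfold need Lefschetz `(1,1)` on the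
fourfold itself, about which the item's hypotheses `LimitExtensionFour` (middle classes only) and
`HypersurfaceHodgeFour` (`H²` of a smooth hypersurface fourfold is `ℚ h`) say nothing; the middle
codimension needs the specialisation of algebraicity (SPREAD) to reach `N¹ H⁴` and then weights
(8.2.8), polarizations (the lift) and `(1,1)` on the resolved divisor to descend to `N² H⁴`.
-/

noncomputable section

-- every declaration of this problem lives in `Summit.HodgeConjecture.HodgeConjecture.…` (summit = sub-problem)
set_option linter.dupNamespace false

open CategoryTheory AlgebraicGeometry
open Literature.AlgebraicGeometry Literature.AlgebraicGeometry.Motives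
open Literature.AlgebraicGeometry.HodgeTheory

namespace Summit.HodgeConjecture.HodgeConjecture.Theorems

/-- **`HodgeFourfolds` (stmt-HodgeConjecture-10866) closed modulo three named facts and SPREAD.**
Granted Lefschetz `(1,1)` (`hL`), Deligne's Hodge III Cor. 8.2.8 (`hD`), the lifting of Hodge
classes along Gysin surjections (`hV`), and SPREAD — for `f : W ⟶ T` flat and proper over a smooth
irreducible curve with smooth projective `2k`-dimensional fibres off `t₀` on which the global class
`B` is algebraic, one Zariski-closed `𝒵 ⊆ W`, of codimension `≥ k` in the special fibre, off whose
slices all `B_t` (`t ≠ t₀`) die (relative Hilbert schemes and flat limits, Voisin II §3.3.1,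
§7.3.2) — Hodge models + `LimitExtensionFour` + `HypersurfaceHodgeFour` give the Hodge conjecture
for every smooth projective complex fourfold: `hodgeFourfolds_of_facts` fed the tree's
`specialisationOfAlgebraicity_of_spread`. [cite: VoisinHodgeII2003, §3.3.1 and §7.3.2]
[cite: VoisinHodgeI2002, Thm. 11.30] [cite: DeligneHodgeIII1974, Cor. 8.2.8]
[cite: Voisin2025, Cor. 2.12] [cite: Murre1977, Remark 1 (p. 230)] [cite: Thomas2005Nodes, Prop. 2] -/
theorem hodgeFourfolds_of_facts_of_spread (hL : lefschetzOneOne_rational)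
    (hD : Deligne1974_ker_restrictCompl_eq_iSup_range_complexGysin)
    (hV : Voisin2025_hodgeClass_lift_complexGysin)
    (spread : ∀ ⦃k : ℕ⦄ ⦃T W : SchemeOver ℂ⦄ (f : W ⟶ T) (t₀ : ComplexPoints T)
      (B : complexBetti W (2 * k)),
      SmoothOfRelativeDimension 1 T.hom → IrreducibleSpace T.left → Flat f.left →
      IsProper f.left →
      (∀ t : ComplexPoints T, t ≠ t₀ → IsSmoothProjective (2 * k) (fiberOver f t) ∧
        complexBetti.map (fiberι f t) (2 * k) B ∈ algebraicClasses (fiberOver f t) k) →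
      ∃ 𝒵 : Set W.left, IsClosed 𝒵 ∧
        (∀ m : ↥(fiberOver f t₀).left, (fiberι f t₀).left.base m ∈ 𝒵 →
          (k : ℕ∞) ≤ Order.coheight m) ∧
        ∀ t : ComplexPoints T, t ≠ t₀ →
          complexBetti.restrictCompl (fiberOver f t) ((fiberι f t).left.base ⁻¹' 𝒵) (2 * k)
            (complexBetti.map (fiberι f t) (2 * k) B) = 0) :
    Theses.LimitExtension.HodgeFourfolds :=
  hodgeFourfolds_of_facts hL hD hV (specialisationOfAlgebraicity_of_spread spread)

/-- **`HodgeFourfolds` on the four LEAVES of its dependency DAG**: GAGA for line bundles (`hG`,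
Serre n° 20 Prop. 18 ⟹ Lefschetz `(1,1)`), Deligne's Hodge III Prop. 8.2.7 (`h827` ⟹ Cor. 8.2.8),
the polarizability of the Hodge structures of smooth projective varieties (`hpol` ⟹ the Gysin lift
of Hodge classes) and SPREAD (⟹ stmt-2998, `specialisationOfAlgebraicity_of_spread`); hard
Lefschetz, Hodge models and de Rham's theorem are tree theorems (`hodgeFourfolds_of_three_leaves`).
This is the complete list of what separates the item from closing.
[cite: SerreGAGA1956, n° 20 Prop. 18] [cite: DeligneHodgeIII1974, Prop. 8.2.7 and Cor. 8.2.8]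
[cite: VoisinHodgeI2002, Thm. 6.32 and Thm. 11.30] [cite: Voisin2025, Prop. 2.11 and Cor. 2.12]
[cite: VoisinHodgeII2003, §3.3.1 and §7.3.2] -/
theorem hodgeFourfolds_of_four_leaves (hG : serreGAGA_lineCocycle_iso_cartierDivisorCocycle)
    (h827 : Deligne1974_ker_pullback_eq_ker_pullback_resolution)
    (hpol : smoothProjective_hodgeStructure_isPolarizable)
    (spread : ∀ ⦃k : ℕ⦄ ⦃T W : SchemeOver ℂ⦄ (f : W ⟶ T) (t₀ : ComplexPoints T)
      (B : complexBetti W (2 * k)),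
      SmoothOfRelativeDimension 1 T.hom → IrreducibleSpace T.left → Flat f.left →
      IsProper f.left →
      (∀ t : ComplexPoints T, t ≠ t₀ → IsSmoothProjective (2 * k) (fiberOver f t) ∧
        complexBetti.map (fiberι f t) (2 * k) B ∈ algebraicClasses (fiberOver f t) k) →
      ∃ 𝒵 : Set W.left, IsClosed 𝒵 ∧
        (∀ m : ↥(fiberOver f t₀).left, (fiberι f t₀).left.base m ∈ 𝒵 →
          (k : ℕ∞) ≤ Order.coheight m) ∧
        ∀ t : ComplexPoints T, t ≠ t₀ →
          complexBetti.restrictCompl (fiberOver f t) ((fiberι f t).left.base ⁻¹' 𝒵) (2 * k)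
            (complexBetti.map (fiberι f t) (2 * k) B) = 0) :
    Theses.LimitExtension.HodgeFourfolds :=
  hodgeFourfolds_of_three_leaves hG h827 hpol (specialisationOfAlgebraicity_of_spread spread)

end Summit.HodgeConjecture.HodgeConjecture.Theorems

end
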